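import Mathlib
import Literature.MathematicalPhysics.QuantumFieldTheory.Balaban1983to89.B6StairStokesTorus
import Literature.MathematicalPhysics.QuantumFieldTheory.Balaban1983to89.BlockAveragingEMLLinearised
import Literature.MathematicalPhysics.QuantumFieldTheory.Balaban1983to89.B5Eq120IterProof

/-!
# `Balaban1983to89.B5AverageCurlStokesV1` — Bałaban's linear block average `Q` of [Balaban1984PropagatorsI] (1.11)∕(1.18) COMMUTES WITH THE
# CURL UP TO STOKES, and Federbush's abelian stability «averaging decreases the action» LOCALIZED AND WEIGHTED — for the V1 lattice
# calculus `LatticeFieldCalculus.bondAvg` on the tori `Site P j` of `Setup` (NODE 00's own carriers), constant exactly `1`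

statement-level skeleton of published theorems with citation tags; proofs where landed; nothing here is a claim about the
Yang–Mills mass gap.

Sources.  T. Bałaban, *Propagators and renormalization transformations for lattice gauge theories. I*, Commun. Math. Phys. **95** (1984)
17–40 [Balaban1984PropagatorsI]: (1.4) p. 18 (plaquette variables), (1.7)–(1.8) pp. 18–19 (straight contours, `A(Γ)`), (1.11) p. 19
(`(QA)(c) = Σ_{x∈B(c₋)} L^{−(d+1)} A([x, x(c)])`, typed `LatticeFieldCalculus.bondAvg`), (1.18) p. 20 (`Q_k`, typed `bondAvgIter`), (1.21)
p. 21; T. Bałaban, *… II*, Commun. Math. Phys. **96** (1984) 223–250 [Balaban1984PropagatorsII], (2.123) p. 244 (the ladder Stokes formula,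
typed `B6StairStokesTorus.runSum_shift_sub`); P. Federbush, *A phase cell approach to Yang–Mills theory. I*, Commun. Math. Phys. **107**
(1986) 319–329 [Federbush1986PhaseCellI], 'Abelian Stability Theorem' (0.12) p. 321, (1.3)–(1.9) pp. 322–323; T. Bałaban, *Large field
renormalization. II*, Commun. Math. Phys. **122** (1989) 355–392 [Balaban1989LargeFieldII], (1.3)–(1.7) pp. 357–358 (the use).

Cell pub-ymgap, HUMAN RULING D-0062 ∕ D-0149, seat `pub-ymgap-dag-n12-w4` (WIDTH SEAT 4 of DAG node N12 = [B15], U2c; key K1⁷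
stmt-QuantumFields-20542, helper, count-neutral).  The tree holds the torus-carrier versions on B5's corner-block torus `Tor (fine n M)`
(`B5AverageCurlStokes`, p185634; localized∕weighted: `B16Ineq17LocalFederbush`, p584067) and the carrier-agnostic stencil version
(`Federbush1986.AbelianStabilityLocal`).  THIS FILE is the V1-CURRENCY version — the tori `Site P j`, bonds `PBond P j`, the V1 average
`bondAvg : VecField P j V → VecField P (j+1) V` and the ordered plaquette variable `B6StairStokesTorus.oc A μ ν s` (= `±LatticeFieldCalculus.curl 1 A`)
— so that the N12 chain's objects (`ιA X : VecField P k ℝ³`, NODE 00's fields on `Site (F.P Kt) 0`, its linearised averaging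
`BlockAveragingEMLLinearised.linAvg = L•bondAvg − (coarse gradient)`) meet the (1.7)-at-flat-background route WITHOUT any transport to B5's
presentation of the torus.

WHAT THIS FILE PROVES (THEOREMS ONLY, no `def`, no `sorry`; standing range `j + 1 ≤ m + K` where blocks do not wrap).
§1 `runSite_comm`, `stepSite_natCast`, `oc_swap`, ★ `squareCirc_eq_sum_oc` — DISCRETE STOKES ON THE `n × n` SQUARE in V1 currency:
   `A([x,x+ne_μ]) + A([x+ne_μ, x+ne_μ+ne_ν]) − A([x+ne_ν, x+ne_ν+ne_μ]) − A([x, x+ne_ν]) = Σ_{s,t<n} oc A μ ν (x + se_μ + te_ν)` (the ladder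
   formula (2.123) `runSum_shift_sub` summed over `n` ladders).
§2 ★ `oc_bondAvg` — «PLAQUETTE OF THE AVERAGE = AVERAGE OF THE SQUARES»: `oc (QA) μ ν y = (L^{d+1})⁻¹ • Σ_r Σ_{s,t<L} oc A μ ν (blockSite y r + se_μ + te_ν)`
   (Federbush I (1.3)–(1.4) ∕ [BalabanImbrieJaffe1985] (2.13) for the typed V1 average; `runSite_blockSite_L`: `x(c) = x + Le_μ` is the site of
   the same offset in the next block).
§3 ★ `normSq_oc_bondAvg_le` — Jensen on the `L^{d+2}`-term stencil: `‖oc (QA) μ ν y‖² ≤ (L^d)⁻¹ · Σ_{r,s,t} ‖oc A μ ν (…)‖²` (any real normed `V`).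
§4 `sum_univ_eq_sum_blockSite` (the blocks partition `T^{(j)}`, `TorusGeometry.blockEquiv`), `sum_runSite_runSite` (translation invariance),
   ★★ `sum_normSq_oc_bondAvg_le_weighted` — FEDERBUSH LOCALIZED AND WEIGHTED, V1: `L^d·Σ_{y∈S}‖oc (QA) μ ν y‖² ≤ L²·Σ_x w(x)‖oc A μ ν x‖²`
   for `w ≥ 0` with `w ≥ 1` on the stencil of `S`; `sum_normSq_oc_le_weighted_of_oc_eq` (the coarse datum `B` matched with `QA` ONLY on `S`).
§5 `oc_grad_eq_zero` (a coarse gradient has no plaquette variables), ★ `oc_linAvg` — NODE 00's LINEARISED (0.4) AVERAGE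
   `BlockAveragingEMLLinearised.linAvg = L•bondAvg − (coarse gradient of the comb means)` ([Balaban1985Averaging] (124)–(125)) has plaquette
   variables `oc (Q₁Y) μ ν y = L • oc (QY) μ ν y`: the gauge tails of (14) drop out of every closed loop, so §4 serves the first-order term of
   NODE 00's one-step average of record verbatim.
§6 ★★ `sum_normSq_oc_bondAvgIter_le` (`B5Eq120IterProof.bondAvgIter_zero∕_succ` by name) (the `k`-fold average `Q_k` of (1.18) down a nested family of plaquette sets
   `S_i`, `i ≤ k ≤ m + K`: `(L^d)^k·Σ_{S_k}‖oc(Q_kA)‖² ≤ (L²)^k·Σ_{S_0}‖oc A‖²`), `sum_normSq_oc_bondAvgIter_le_weighted` (`ζ ≥ 1` on `S_0`), ★★ `sum_normSq_oc_chain_le` (any chain `Y_i` with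
   `oc (Y_{i+1}) = c • oc (Q Y_i)` on `S_{i+1}` — e.g. the iterate of NODE 00's `linAvg`, `c = L`).
§7 ★★ `sum_plaq_normSq_oc_bondAvg_le_weighted` — §4 summed over the planes in the `Σ_{p : Plaq}` indexing of `curlAction` and of dag-n12-w2's
   `Node00.deriv_deriv_wilsonAction4_expChart_one_eq_norm_sq` (`σ⁰_p = oc X p.μ p.ν p.src`).

HONEST SCOPE.  Finite algebra (telescoping, Jensen, block bijection, translation invariance) about the typed LINEAR average at `U = 1`;
nothing of Bałaban's asserted; the identification of NODE 00's linearised averaging of record with `bondAvg` (resp. `linAvg`) iterates and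
of the second variation at background `1` with the `ζ₀`-weighted flat form are the N12 lanes' (U2b ∕ U2a), displayed where used, not
discharged.  Count-neutral; N12 NOT discharged; one finite 𝕋⁴ programme at fixed
`ε`; R4 closes the conditional rung `BalabanLadder.UV` only; nothing continuum ∕ ℝ⁴ ∕ OS ∕ mass gap ∕ Clay.
-/

noncomputable section

open scoped BigOperators
open Finset

namespace Literature.MathematicalPhysics.QuantumFieldTheory.Balaban1983to89.B5AverageCurlStokesV1

open LatticeFieldCalculus
open B6StairStokesTorus (oc stepSite runSum_shift_sub zsum_ofNat stepSite_zero)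
open B5Eq120IterProof (bondAvgIter_zero bondAvgIter_succ)

variable {P : Params} {j : ℕ}

/-! ## §1  Discrete Stokes on the `n × n` square, V1 currency -/

section Square

variable {V : Type*} [AddCommGroup V]

omit [AddCommGroup V] in
/-- Runs in different directions commute: `(x + se_μ) + te_ν = (x + te_ν) + se_μ`. [folklore] -/
private theorem runSite_comm (x : Site P j) {μ ν : Fin P.d} (hμν : μ ≠ ν) (s t : ℕ) :
    runSite (runSite x μ s) ν t = runSite (runSite x ν t) μ s := by
  simp only [runSite]
  rw [Function.update_of_ne (Ne.symm hμν), Function.update_of_ne hμν, Function.update_comm (Ne.symm hμν)]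

omit [AddCommGroup V] in
/-- A signed run of a natural number of steps is the unsigned run. [folklore] -/
private theorem stepSite_natCast (z : Site P j) (ν : Fin P.d) (t : ℕ) : stepSite P j z ν (t : ℤ) = runSite z ν t := by
  simp only [stepSite, runSite, Int.cast_natCast]

/-- Reversing the order of the two directions reverses the orientation: `oc A ν μ s = −oc A μ ν s`. [cite: Balaban1984PropagatorsI, (1.4) p.18] -/
theorem oc_swap (A : VecField P j V) (μ ν : Fin P.d) (s : Site P j) : oc A ν μ s = -oc A μ ν s := by
  simp only [oc]
  abel

/-- One ladder of (2.123) in unsigned form: `A([x+e_μ, x+e_μ+ne_ν]) − A([x, x+ne_ν]) = A⟨x+ne_ν, μ⟩ − A⟨x, μ⟩ − Σ_{t<n} oc A ν μ (x + te_ν)`.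
[cite: Balaban1984PropagatorsII, (2.123) p.244] -/
theorem segSum_shift_sub (A : VecField P j V) (x : Site P j) {μ ν : Fin P.d} (hμν : μ ≠ ν) (n : ℕ) :
    segSum A (x.shift μ) ν n - segSum A x ν n =
      A ⟨runSite x ν n, μ⟩ - A ⟨x, μ⟩ - ∑ t ∈ Finset.range n, oc A ν μ (runSite x ν t) := by
  have h := runSum_shift_sub A x (Ne.symm hμν) (n : ℤ)
  rw [runSum_ofNat, runSum_ofNat, zsum_ofNat, stepSite_natCast] at h
  rw [h]
  congr 1
  exact Finset.sum_congr rfl fun t _ => by rw [stepSite_natCast]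

/-- ★ **DISCRETE STOKES ON THE `n × n` SQUARE** based at `x` in the `(μ, ν)` plane (`μ ≠ ν`): the boundary circulation
`A([x, x+ne_μ]) + A([x+ne_μ, x+ne_μ+ne_ν]) − A([x+ne_ν, x+ne_ν+ne_μ]) − A([x, x+ne_ν])` is the sum of the `n²` plaquette variables
`oc A μ ν (x + se_μ + te_ν)` inside (Federbush I (1.3)→(1.4) for Γ = a coarse plaquette; `n` ladders of (2.123)).
[cite: Federbush1986PhaseCellI, (1.3)–(1.4) p.322; Balaban1984PropagatorsII, (2.123) p.244] -/
theorem squareCirc_eq_sum_oc (A : VecField P j V) (x : Site P j) {μ ν : Fin P.d} (hμν : μ ≠ ν) (n : ℕ) :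
    segSum A x μ n + segSum A (runSite x μ n) ν n - segSum A (runSite x ν n) μ n - segSum A x ν n
      = ∑ s ∈ Finset.range n, ∑ t ∈ Finset.range n, oc A μ ν (runSite (runSite x μ s) ν t) := by
  -- the `n` ladders: telescoping in `s` of the `ν`-runs based at `x + se_μ`
  have hlad : ∀ s : ℕ, segSum A (runSite x μ (s + 1)) ν n - segSum A (runSite x μ s) ν n =
      A ⟨runSite (runSite x μ s) ν n, μ⟩ - A ⟨runSite x μ s, μ⟩
        - ∑ t ∈ Finset.range n, oc A ν μ (runSite (runSite x μ s) ν t) := by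
    intro s
    rw [runSite_succ]
    exact segSum_shift_sub A (runSite x μ s) hμν n
  have htel : segSum A (runSite x μ n) ν n - segSum A x ν n =
      ∑ s ∈ Finset.range n, (segSum A (runSite x μ (s + 1)) ν n - segSum A (runSite x μ s) ν n) := by
    rw [Finset.sum_range_sub (fun s => segSum A (runSite x μ s) ν n) n, runSite_zero]
  have hsum : ∑ s ∈ Finset.range n, (segSum A (runSite x μ (s + 1)) ν n - segSum A (runSite x μ s) ν n) =
      ∑ s ∈ Finset.range n, A ⟨runSite (runSite x μ s) ν n, μ⟩ - ∑ s ∈ Finset.range n, A ⟨runSite x μ s, μ⟩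
        - ∑ s ∈ Finset.range n, ∑ t ∈ Finset.range n, oc A ν μ (runSite (runSite x μ s) ν t) := by
    rw [← Finset.sum_sub_distrib, ← Finset.sum_sub_distrib]
    exact Finset.sum_congr rfl fun s _ => hlad s
  -- the two families of rungs are the `μ`-runs at `x + ne_ν` and at `x`
  have hrung : ∑ s ∈ Finset.range n, A ⟨runSite (runSite x μ s) ν n, μ⟩ = segSum A (runSite x ν n) μ n := by
    simp only [segSum, runBond]
    exact Finset.sum_congr rfl fun s _ => by rw [runSite_comm x hμν s n]
  have hbase : ∑ s ∈ Finset.range n, A ⟨runSite x μ s, μ⟩ = segSum A x μ n := rfl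
  have hoc : ∑ s ∈ Finset.range n, ∑ t ∈ Finset.range n, oc A ν μ (runSite (runSite x μ s) ν t) =
      -∑ s ∈ Finset.range n, ∑ t ∈ Finset.range n, oc A μ ν (runSite (runSite x μ s) ν t) := by
    rw [← Finset.sum_neg_distrib]
    refine Finset.sum_congr rfl fun s _ => ?_
    rw [← Finset.sum_neg_distrib]
    exact Finset.sum_congr rfl fun t _ => oc_swap A μ ν _
  rw [hsum, hrung, hbase, hoc] at htel
  -- `htel : S(x+nμ,ν) − S(x,ν) = S(x+nν,μ) − S(x,μ) − (−ΣΣ oc)`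
  calc segSum A x μ n + segSum A (runSite x μ n) ν n - segSum A (runSite x ν n) μ n - segSum A x ν n
      = (segSum A (runSite x μ n) ν n - segSum A x ν n) - (segSum A (runSite x ν n) μ n - segSum A x μ n) := by abel
    _ = ∑ s ∈ Finset.range n, ∑ t ∈ Finset.range n, oc A μ ν (runSite (runSite x μ s) ν t) := by rw [htel]; abel

end Square

/-! ## §2  The plaquette of the block average is the average of the squares -/

section Average

variable {V : Type*} [AddCommGroup V] [Module ℝ V]

/-- ★ **«PLAQUETTE AVERAGING = CLOSED-LOOP AVERAGING» FOR THE V1 AVERAGE** (standing range): for a unit plaquette of `T^{(j+1)}` at `y` in the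
`(μ, ν)` plane, `oc (QA) μ ν y = (L^{d+1})⁻¹ • Σ_r Σ_{s,t<L} oc A μ ν (blockSite y r + se_μ + te_ν)` — the mean over the `L^d` base points of
the block of the boundary circulations of the translated `L × L` squares, each written by §1 as the sum of its `L²` fine plaquette
variables (`LatticeFieldCalculus.runSite_blockSite_L`: `x + Le_μ` is the site of the same offset in the block of `y + e_μ`).
[cite: Federbush1986PhaseCellI, (1.3)–(1.4) p.322; Balaban1984PropagatorsI, (1.11) p.19, (1.18) p.20] -/
theorem oc_bondAvg (hj : j + 1 ≤ P.m + P.K) (A : VecField P j V) {μ ν : Fin P.d} (hμν : μ ≠ ν) (y : Site P (j + 1)) :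
    oc (bondAvg A) μ ν y = (((P.L : ℝ) ^ (P.d + 1))⁻¹) •
      ∑ r : Fin P.d → Fin P.L, ∑ s ∈ Finset.range P.L, ∑ t ∈ Finset.range P.L,
        oc A μ ν (runSite (runSite (Site.blockSite y r) μ s) ν t) := by
  have hoc : oc (bondAvg A) μ ν y
      = bondAvg A ⟨y, μ⟩ + bondAvg A ⟨y.shift μ, ν⟩ - bondAvg A ⟨y.shift ν, μ⟩ - bondAvg A ⟨y, ν⟩ := rfl
  rw [hoc]
  simp only [bondAvg]
  rw [← smul_add, ← smul_sub, ← smul_sub, ← Finset.sum_add_distrib, ← Finset.sum_sub_distrib, ← Finset.sum_sub_distrib]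
  congr 1
  refine Finset.sum_congr rfl fun r _ => ?_
  -- the four straight contours of the translated square at `x = blockSite y r`
  have h1 : Site.blockSite (y.shift μ) r = runSite (Site.blockSite y r) μ P.L := (runSite_blockSite_L hj y r μ).symm
  have h2 : Site.blockSite (y.shift ν) r = runSite (Site.blockSite y r) ν P.L := (runSite_blockSite_L hj y r ν).symm
  rw [h1, h2]
  exact squareCirc_eq_sum_oc A (Site.blockSite y r) hμν P.L

end Average

/-! ## §3  Jensen on the stencil -/

section Jensen

variable {V : Type*} [NormedAddCommGroup V] [NormedSpace ℝ V]

omit [NormedSpace ℝ V] in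
/-- Jensen ∕ Cauchy–Schwarz for the block-and-square sum in a real normed space: `‖Σ_r Σ_s Σ_t z‖² ≤ L^d·L·L · Σ_r Σ_s Σ_t ‖z‖²`. [folklore] -/
private theorem normSq_tripleSum_le (L d : ℕ) (z : (Fin d → Fin L) → ℕ → ℕ → V) :
    ‖∑ r : Fin d → Fin L, ∑ s ∈ Finset.range L, ∑ t ∈ Finset.range L, z r s t‖ ^ 2
      ≤ (L : ℝ) ^ (d + 2) * ∑ r : Fin d → Fin L, ∑ s ∈ Finset.range L, ∑ t ∈ Finset.range L, ‖z r s t‖ ^ 2 := by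
  have hflat : ∑ r : Fin d → Fin L, ∑ s ∈ Finset.range L, ∑ t ∈ Finset.range L, z r s t
      = ∑ p ∈ (Finset.univ : Finset (Fin d → Fin L)) ×ˢ (Finset.range L ×ˢ Finset.range L), z p.1 p.2.1 p.2.2 := by
    rw [Finset.sum_product]
    exact Finset.sum_congr rfl fun r _ => by rw [Finset.sum_product]
  have hflat' : ∑ r : Fin d → Fin L, ∑ s ∈ Finset.range L, ∑ t ∈ Finset.range L, ‖z r s t‖ ^ 2
      = ∑ p ∈ (Finset.univ : Finset (Fin d → Fin L)) ×ˢ (Finset.range L ×ˢ Finset.range L), ‖z p.1 p.2.1 p.2.2‖ ^ 2 := by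
    rw [Finset.sum_product]
    exact Finset.sum_congr rfl fun r _ => by rw [Finset.sum_product]
  rw [hflat, hflat']
  have hcard : ((Finset.univ : Finset (Fin d → Fin L)) ×ˢ (Finset.range L ×ˢ Finset.range L)).card = L ^ (d + 2) := by
    rw [Finset.card_product, Finset.card_product, Finset.card_univ, Fintype.card_fun, Fintype.card_fin, Fintype.card_fin,
      Finset.card_range]
    ring
  calc ‖∑ p ∈ (Finset.univ : Finset (Fin d → Fin L)) ×ˢ (Finset.range L ×ˢ Finset.range L), z p.1 p.2.1 p.2.2‖ ^ 2
      ≤ (∑ p ∈ (Finset.univ : Finset (Fin d → Fin L)) ×ˢ (Finset.range L ×ˢ Finset.range L), ‖z p.1 p.2.1 p.2.2‖) ^ 2 := by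
        gcongr
        exact norm_sum_le _ _
    _ ≤ ((Finset.univ : Finset (Fin d → Fin L)) ×ˢ (Finset.range L ×ˢ Finset.range L)).card
          * ∑ p ∈ (Finset.univ : Finset (Fin d → Fin L)) ×ˢ (Finset.range L ×ˢ Finset.range L), ‖z p.1 p.2.1 p.2.2‖ ^ 2 :=
        sq_sum_le_card_mul_sum_sq
    _ = (L : ℝ) ^ (d + 2) * ∑ p ∈ (Finset.univ : Finset (Fin d → Fin L)) ×ˢ (Finset.range L ×ˢ Finset.range L),
          ‖z p.1 p.2.1 p.2.2‖ ^ 2 := by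
        rw [hcard]; push_cast; ring

/-- ★ **ONE COARSE PLAQUETTE, JENSEN ON ITS STENCIL** (standing range, `μ ≠ ν`): `‖oc (QA) μ ν y‖² ≤ (L^d)⁻¹·Σ_{r,s,t} ‖oc A μ ν (blockSite y r + se_μ + te_ν)‖²`.
[cite: Federbush1986PhaseCellI, (1.5)–(1.9) p.323; Balaban1984PropagatorsI, (1.11) p.19] -/
theorem normSq_oc_bondAvg_le (hj : j + 1 ≤ P.m + P.K) (A : VecField P j V) {μ ν : Fin P.d} (hμν : μ ≠ ν) (y : Site P (j + 1)) :
    ‖oc (bondAvg A) μ ν y‖ ^ 2 ≤ ((P.L : ℝ) ^ P.d)⁻¹ *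
      ∑ r : Fin P.d → Fin P.L, ∑ s ∈ Finset.range P.L, ∑ t ∈ Finset.range P.L,
        ‖oc A μ ν (runSite (runSite (Site.blockSite y r) μ s) ν t)‖ ^ 2 := by
  have hL : (0 : ℝ) < P.L := by exact_mod_cast P.L_pos
  rw [oc_bondAvg hj A hμν y, norm_smul, mul_pow, norm_inv, norm_pow, Real.norm_natCast]
  have key := normSq_tripleSum_le P.L P.d (fun r s t => oc A μ ν (runSite (runSite (Site.blockSite y r) μ s) ν t))
  have hsc : (((P.L : ℝ) ^ (P.d + 1))⁻¹) ^ 2 * (P.L : ℝ) ^ (P.d + 2) = ((P.L : ℝ) ^ P.d)⁻¹ := by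
    have hL0 : (P.L : ℝ) ≠ 0 := hL.ne'
    field_simp
    ring
  calc (((P.L : ℝ) ^ (P.d + 1))⁻¹) ^ 2 * ‖∑ r : Fin P.d → Fin P.L, ∑ s ∈ Finset.range P.L, ∑ t ∈ Finset.range P.L,
          oc A μ ν (runSite (runSite (Site.blockSite y r) μ s) ν t)‖ ^ 2
      ≤ (((P.L : ℝ) ^ (P.d + 1))⁻¹) ^ 2 * ((P.L : ℝ) ^ (P.d + 2) *
          ∑ r : Fin P.d → Fin P.L, ∑ s ∈ Finset.range P.L, ∑ t ∈ Finset.range P.L,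
            ‖oc A μ ν (runSite (runSite (Site.blockSite y r) μ s) ν t)‖ ^ 2) :=
        mul_le_mul_of_nonneg_left key (by positivity)
    _ = ((P.L : ℝ) ^ P.d)⁻¹ * ∑ r : Fin P.d → Fin P.L, ∑ s ∈ Finset.range P.L, ∑ t ∈ Finset.range P.L,
            ‖oc A μ ν (runSite (runSite (Site.blockSite y r) μ s) ν t)‖ ^ 2 := by
        rw [← mul_assoc, hsc]

end Jensen

/-! ## §4  Federbush's abelian stability for the V1 average, localized and weighted -/

section Local

variable {V : Type*} [NormedAddCommGroup V] [NormedSpace ℝ V]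

omit [NormedSpace ℝ V] in
/-- **The blocks partition `T^{(j)}`** (standing range): `Σ_x g(x) = Σ_y Σ_r g(blockSite y r)` (`TorusGeometry.blockEquiv`; [B5] (1.6) «we divide
T₁ into blocks B(y)»). [cite: Balaban1984PropagatorsI, (1.6) p.18] -/
theorem sum_univ_eq_sum_blockSite (hj : j + 1 ≤ P.m + P.K) {M : Type*} [AddCommMonoid M] (g : Site P j → M) :
    ∑ x, g x = ∑ y : Site P (j + 1), ∑ r : Fin P.d → Fin P.L, g (Site.blockSite y r) := by
  classical
  rw [← Finset.sum_fiberwise_of_maps_to (s := (Finset.univ : Finset (Site P j))) (t := (Finset.univ : Finset (Site P (j + 1))))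
    (g := fun x => blockOf x) (fun x _ => Finset.mem_univ _)]
  refine Finset.sum_congr rfl fun y _ => ?_
  have hmem : ∀ x : Site P j, blockOf x = y ↔ x ∈ block y := fun x => by simp [block]
  let e : (Fin P.d → Fin P.L) ≃ ↥(block y) := (Site.blockEquiv hj y).symm.trans (Equiv.subtypeEquivRight hmem)
  have hfilter : (Finset.univ.filter fun x : Site P j => blockOf x = y) = block y := by
    ext x; simp [block]
  rw [hfilter, ← Finset.sum_coe_sort (block y) g, ← Equiv.sum_comp e (fun a => g a.1)]
  exact Finset.sum_congr rfl fun r _ => rfl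

omit [NormedSpace ℝ V] in
/-- **Translation invariance** of a full torus sum under `x ↦ x + se_μ`. [folklore] -/
private theorem sum_runSite {M : Type*} [AddCommMonoid M] (g : Site P j → M) (μ : Fin P.d) (s : ℕ) :
    ∑ x, g (runSite x μ s) = ∑ x, g x := by
  refine Fintype.sum_equiv ⟨fun x => runSite x μ s, fun x => Function.update x μ (x μ - s), fun x => ?_, fun x => ?_⟩ _ _ fun _ => rfl
  · funext κ
    by_cases h : κ = μ
    · subst h; simp [runSite]
    · simp [runSite, Function.update_of_ne h]
  · funext κ
    by_cases h : κ = μ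
    · subst h; simp [runSite]
    · simp [runSite, Function.update_of_ne h]

omit [NormedSpace ℝ V] in
/-- Translation invariance under the two-step stencil map `x ↦ x + se_μ + te_ν`. [folklore] -/
private theorem sum_runSite_runSite {M : Type*} [AddCommMonoid M] (g : Site P j → M) (μ ν : Fin P.d) (s t : ℕ) :
    ∑ x, g (runSite (runSite x μ s) ν t) = ∑ x, g x := by
  rw [sum_runSite (fun x => g (runSite x ν t)) μ s, sum_runSite g ν t]

omit [NormedSpace ℝ V] in
/-- Swapping an outer pair of `Fintype` sums with an inner pair of `Finset` sums. [folklore] -/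
private theorem sum_comm_22 {α β γ δ : Type*} [Fintype α] [Fintype β] (S : Finset γ) (T : Finset δ) (G : α → β → γ → δ → ℝ) :
    (∑ a, ∑ b, ∑ c ∈ S, ∑ e ∈ T, G a b c e) = ∑ c ∈ S, ∑ e ∈ T, ∑ a, ∑ b, G a b c e := by
  have l1 : (∑ a, ∑ b, ∑ c ∈ S, ∑ e ∈ T, G a b c e) = ∑ p : α × β, ∑ q ∈ S ×ˢ T, G p.1 p.2 q.1 q.2 := by
    rw [Fintype.sum_prod_type]
    exact Finset.sum_congr rfl fun a _ => Finset.sum_congr rfl fun b _ => by rw [Finset.sum_product]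
  have r1 : (∑ c ∈ S, ∑ e ∈ T, ∑ a, ∑ b, G a b c e) = ∑ q ∈ S ×ˢ T, ∑ p : α × β, G p.1 p.2 q.1 q.2 := by
    rw [Finset.sum_product]
    exact Finset.sum_congr rfl fun c _ => Finset.sum_congr rfl fun e _ => by rw [Fintype.sum_prod_type]
  rw [l1, r1, Finset.sum_comm]

/-- ★★ **FEDERBUSH'S ABELIAN STABILITY FOR THE V1 AVERAGE, LOCALIZED AND WEIGHTED** (standing range, per ordered pair of directions `μ ≠ ν`,
every real normed `V`): for a set `S` of unit plaquettes of `T^{(j+1)}` and a fine weight `w ≥ 0` that is `≥ 1` on the stencils of `S`,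
`L^d · Σ_{y∈S} ‖oc (QA) μ ν y‖² ≤ L² · Σ_x w(x)·‖oc A μ ν x‖²` — «averaging decreases the action» with supports and weights tracked
(each fine plaquette is met by at most `L²` (base point, offset) pairs, only stencil plaquettes are met).  In B5's units ((1.21):
`F^{(1)} = oc` on `T^{(j+1)}`, `F^{(η)} = η⁻¹·oc` and site weight `η^d` on `T^{(j)}`, `η = L⁻¹`) this is `‖∂₁(QA)‖²_S ≤ ⟨A, Δ^{flat}(w)A⟩_η`,
constant exactly `1`. [cite: Federbush1986PhaseCellI, 'Abelian Stability Theorem' (0.12) p.321, (1.3)–(1.9) pp.322–323;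
Balaban1984PropagatorsI, (1.11) p.19, (1.18) p.20, (1.21) p.21; Balaban1989LargeFieldII, (1.6)–(1.7) pp.357–358] -/
theorem sum_normSq_oc_bondAvg_le_weighted (hj : j + 1 ≤ P.m + P.K) (A : VecField P j V) {μ ν : Fin P.d} (hμν : μ ≠ ν)
    (S : Finset (Site P (j + 1))) (w : Site P j → ℝ) (hw0 : ∀ x, 0 ≤ w x)
    (hw1 : ∀ y ∈ S, ∀ (r : Fin P.d → Fin P.L) (s t : ℕ), s < P.L → t < P.L →
      1 ≤ w (runSite (runSite (Site.blockSite y r) μ s) ν t)) :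
    (P.L : ℝ) ^ P.d * ∑ y ∈ S, ‖oc (bondAvg A) μ ν y‖ ^ 2
      ≤ (P.L : ℝ) ^ 2 * ∑ x, w x * ‖oc A μ ν x‖ ^ 2 := by
  have hL : (0 : ℝ) < P.L := by exact_mod_cast P.L_pos
  set g : Site P j → ℝ := fun x => w x * ‖oc A μ ν x‖ ^ 2 with hg
  have hg0 : ∀ x, 0 ≤ g x := fun x => mul_nonneg (hw0 x) (by positivity)
  -- pointwise on `S`
  have hpt : ∀ y ∈ S, (P.L : ℝ) ^ P.d * ‖oc (bondAvg A) μ ν y‖ ^ 2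
      ≤ ∑ r : Fin P.d → Fin P.L, ∑ s ∈ Finset.range P.L, ∑ t ∈ Finset.range P.L,
          g (runSite (runSite (Site.blockSite y r) μ s) ν t) := by
    intro y hy
    have h1 := normSq_oc_bondAvg_le hj A hμν y
    have h2 : ∑ r : Fin P.d → Fin P.L, ∑ s ∈ Finset.range P.L, ∑ t ∈ Finset.range P.L,
          ‖oc A μ ν (runSite (runSite (Site.blockSite y r) μ s) ν t)‖ ^ 2
        ≤ ∑ r : Fin P.d → Fin P.L, ∑ s ∈ Finset.range P.L, ∑ t ∈ Finset.range P.L,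
          g (runSite (runSite (Site.blockSite y r) μ s) ν t) := by
      refine Finset.sum_le_sum fun r _ => Finset.sum_le_sum fun s hs => Finset.sum_le_sum fun t ht => ?_
      simp only [hg]
      exact le_mul_of_one_le_left (by positivity) (hw1 y hy r s t (Finset.mem_range.mp hs) (Finset.mem_range.mp ht))
    calc (P.L : ℝ) ^ P.d * ‖oc (bondAvg A) μ ν y‖ ^ 2
        ≤ (P.L : ℝ) ^ P.d * (((P.L : ℝ) ^ P.d)⁻¹ * ∑ r : Fin P.d → Fin P.L, ∑ s ∈ Finset.range P.L, ∑ t ∈ Finset.range P.L,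
            ‖oc A μ ν (runSite (runSite (Site.blockSite y r) μ s) ν t)‖ ^ 2) := mul_le_mul_of_nonneg_left h1 (by positivity)
      _ = ∑ r : Fin P.d → Fin P.L, ∑ s ∈ Finset.range P.L, ∑ t ∈ Finset.range P.L,
            ‖oc A μ ν (runSite (runSite (Site.blockSite y r) μ s) ν t)‖ ^ 2 := by
          rw [← mul_assoc, mul_inv_cancel₀ (by positivity), one_mul]
      _ ≤ _ := h2
  -- the full block-and-square sum of `g` is `L²` copies of the full sum
  have hre : ∑ y : Site P (j + 1), ∑ r : Fin P.d → Fin P.L, ∑ s ∈ Finset.range P.L, ∑ t ∈ Finset.range P.L,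
        g (runSite (runSite (Site.blockSite y r) μ s) ν t) = (P.L : ℝ) ^ 2 * ∑ x, g x := by
    rw [sum_comm_22 (Finset.range P.L) (Finset.range P.L)
      (fun (y : Site P (j + 1)) (r : Fin P.d → Fin P.L) (s t : ℕ) => g (runSite (runSite (Site.blockSite y r) μ s) ν t))]
    have step2 : ∀ s t : ℕ, ∑ y : Site P (j + 1), ∑ r : Fin P.d → Fin P.L, g (runSite (runSite (Site.blockSite y r) μ s) ν t)
        = ∑ x, g x := by
      intro s t
      rw [← sum_univ_eq_sum_blockSite hj (fun x => g (runSite (runSite x μ s) ν t))]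
      exact sum_runSite_runSite g μ ν s t
    simp_rw [step2]
    simp only [Finset.sum_const, Finset.card_range, nsmul_eq_mul]
    ring
  calc (P.L : ℝ) ^ P.d * ∑ y ∈ S, ‖oc (bondAvg A) μ ν y‖ ^ 2
      = ∑ y ∈ S, (P.L : ℝ) ^ P.d * ‖oc (bondAvg A) μ ν y‖ ^ 2 := Finset.mul_sum _ _ _
    _ ≤ ∑ y ∈ S, ∑ r : Fin P.d → Fin P.L, ∑ s ∈ Finset.range P.L, ∑ t ∈ Finset.range P.L,
          g (runSite (runSite (Site.blockSite y r) μ s) ν t) := Finset.sum_le_sum hpt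
    _ ≤ ∑ y : Site P (j + 1), ∑ r : Fin P.d → Fin P.L, ∑ s ∈ Finset.range P.L, ∑ t ∈ Finset.range P.L,
          g (runSite (runSite (Site.blockSite y r) μ s) ν t) :=
        Finset.sum_le_sum_of_subset_of_nonneg (Finset.subset_univ S) fun y _ _ =>
          Finset.sum_nonneg fun r _ => Finset.sum_nonneg fun s _ => Finset.sum_nonneg fun t _ => hg0 _
    _ = (P.L : ℝ) ^ 2 * ∑ x, g x := hre
    _ = (P.L : ℝ) ^ 2 * ∑ x, w x * ‖oc A μ ν x‖ ^ 2 := by simp only [hg]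

/-- **Fibre ∕ local-constraint form**: if the coarse field `B` has the plaquette variables of `QA` ON THE PLAQUETTES OF `S` (the block averages
of `A` reproduce `B` there — e.g. `A` = the flat linearised minimiser of the `Z`-problem, [Balaban1989LargeFieldII] (1.3)), then
`L^d · Σ_{y∈S} ‖oc B μ ν y‖² ≤ L² · Σ_x w(x)·‖oc A μ ν x‖²`.  No minimality, decay or gauge condition on `A`.
[cite: Federbush1986PhaseCellI, 'Abelian Stability Theorem' (0.12) p.321; Balaban1989LargeFieldII, (1.3) p.357, (1.7) p.358] -/
theorem sum_normSq_oc_le_weighted_of_oc_eq (hj : j + 1 ≤ P.m + P.K) (A : VecField P j V) (B : VecField P (j + 1) V)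
    {μ ν : Fin P.d} (hμν : μ ≠ ν) (S : Finset (Site P (j + 1))) (hB : ∀ y ∈ S, oc B μ ν y = oc (bondAvg A) μ ν y)
    (w : Site P j → ℝ) (hw0 : ∀ x, 0 ≤ w x)
    (hw1 : ∀ y ∈ S, ∀ (r : Fin P.d → Fin P.L) (s t : ℕ), s < P.L → t < P.L →
      1 ≤ w (runSite (runSite (Site.blockSite y r) μ s) ν t)) :
    (P.L : ℝ) ^ P.d * ∑ y ∈ S, ‖oc B μ ν y‖ ^ 2 ≤ (P.L : ℝ) ^ 2 * ∑ x, w x * ‖oc A μ ν x‖ ^ 2 := by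
  calc (P.L : ℝ) ^ P.d * ∑ y ∈ S, ‖oc B μ ν y‖ ^ 2 = (P.L : ℝ) ^ P.d * ∑ y ∈ S, ‖oc (bondAvg A) μ ν y‖ ^ 2 := by
        rw [Finset.sum_congr rfl fun y hy => by rw [hB y hy]]
    _ ≤ (P.L : ℝ) ^ 2 * ∑ x, w x * ‖oc A μ ν x‖ ^ 2 := sum_normSq_oc_bondAvg_le_weighted hj A hμν S w hw0 hw1

end Local

/-! ## §5  Coarse gradients are invisible to plaquettes: NODE 00's linearised (0.4) average `linAvg` -/

section LinAvg

variable {V : Type*} [AddCommGroup V]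

omit [AddCommGroup V] in
/-- Lattice steps commute (re-proof of the private `LatticeFieldCalculus.shift_comm`). [folklore] -/
private theorem shift_comm' (x : Site P j) (μ ν : Fin P.d) : (x.shift μ).shift ν = (x.shift ν).shift μ := by
  funext κ
  simp only [Site.shift]
  rcases eq_or_ne κ ν with hν | hν
  · subst hν
    rcases eq_or_ne κ μ with hμ | hμ
    · subst hμ; rfl
    · rw [Function.update_self, Function.update_of_ne hμ, Function.update_of_ne hμ, Function.update_self]
  · rw [Function.update_of_ne hν]
    rcases eq_or_ne κ μ with hμ | hμ
    · subst hμ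
      rw [Function.update_self, Function.update_self, Function.update_of_ne hν]
    · rw [Function.update_of_ne hμ, Function.update_of_ne hμ, Function.update_of_ne hν]

/-- **A coarse gradient has no plaquette variables**: `oc (dλ) μ ν y = 0` for `(dλ)_b = λ(b₊) − λ(b₋)` ([B5] (1.9)∕(1.13): the averages of a gauge
transformation are a coarse gradient, invisible to `∂₁`). [cite: Balaban1984PropagatorsI, (1.9) p.19, (1.13) p.19] -/
theorem oc_grad_eq_zero {k : ℕ} (lam : Site P k → V) (μ ν : Fin P.d) (y : Site P k) :
    oc (fun b : PBond P k => lam b.tgt - lam b.src) μ ν y = 0 := by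
  simp only [oc, PBond.tgt]
  rw [shift_comm' y μ ν]
  abel

/-- ★ **THE PLAQUETTE VARIABLES OF NODE 00's LINEARISED (0.4) AVERAGE ARE `L` TIMES THOSE OF THE STRAIGHT-LINE AVERAGE**:
`oc (Q₁Y) μ ν y = L • oc (QY) μ ν y` — by `BlockAveragingEMLLinearised.linAvg_eq_bondAvg_sub_grad_combMean` the linearised (0.4) average is
`L•bondAvg − (coarse gradient of the comb means)`, and coarse gradients carry no plaquette variable (`oc_grad_eq_zero`).  Hence §4 applies
verbatim to the first-order term of NODE 00's one-step average of record ([Balaban1985Averaging] (124)–(125): the gauge tails of (14) drop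
out of every closed loop). [cite: Balaban1985Averaging, (124)-(125) p.36; Balaban1984PropagatorsI, (1.11) p.19] -/
theorem oc_linAvg {n : Type*} [Fintype n] [DecidableEq n] [Nonempty n] (Y : PBond P j → Matrix n n ℂ) (μ ν : Fin P.d)
    (y : Site P (j + 1)) :
    oc (BlockAveragingEMLLinearised.linAvg Y) μ ν y = ((P.L : ℕ) : ℂ) • oc (bondAvg Y) μ ν y := by
  have h : ∀ c : PBond P (j + 1), BlockAveragingEMLLinearised.linAvg Y c =
      ((P.L : ℕ) : ℂ) • bondAvg Y c - (BlockAveragingEMLLinearised.combMean Y c.tgt - BlockAveragingEMLLinearised.combMean Y c.src) :=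
    BlockAveragingEMLLinearised.linAvg_eq_bondAvg_sub_grad_combMean Y
  have hg := oc_grad_eq_zero (BlockAveragingEMLLinearised.combMean Y) μ ν y
  simp only [oc] at hg ⊢
  rw [h, h, h, h]
  simp only [smul_add, smul_sub]
  -- the gradient parts cancel by `hg`
  have e : ∀ a b c d e f g k : Matrix n n ℂ,
      a - e + (b - f) - (c - g) - (d - k) = (a + b - c - d) - (e + f - g - k) := fun _ _ _ _ _ _ _ _ => by abel
  rw [e, hg, sub_zero]

end LinAvg

/-! ## §6  The `k`-fold average `Q_k` ([B5] (1.18)): iterating §4 down a nested family of plaquette sets -/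

section Iterate

variable {V : Type*} [NormedAddCommGroup V] [NormedSpace ℝ V]

/-- ★★ **FEDERBUSH FOR THE `k`-FOLD V1 AVERAGE `Q_k`, LOCALIZED**: for a nested family of plaquette sets `S_i ⊂ T^{(i)}`, `i ≤ k ≤ m + K`,
with the stencil of every plaquette of `S_{i+1}` contained in `S_i`, `(L^d)^k · Σ_{y∈S_k} ‖oc (Q_kA) μ ν y‖² ≤ (L²)^k · Σ_{x∈S_0} ‖oc A μ ν x‖²` —
§4 with the indicator weight of `S_i`, `k` times; in B5's units (`η = L^{−k}`, `F^{(η)} = η⁻¹oc`, weight `η^d`): `‖∂₁(Q_kA)‖²_{S_k} ≤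
Σ_{x∈S_0} η^d‖F^η(A)(x)‖²`, constant `1` — the lower bound [Balaban1989LargeFieldII] (1.7) at flat background reads with `γ₀ = 1` for EVERY
fine field whose `k`-fold averages reproduce `B′` on `S_k`. [cite: Federbush1986PhaseCellI, 'Abelian Stability Theorem' (0.12) p.321;
Balaban1984PropagatorsI, (1.18) p.20, (1.21) p.21; Balaban1989LargeFieldII, (1.7) p.358] -/
theorem sum_normSq_oc_bondAvgIter_le (k : ℕ) (hk : k ≤ P.m + P.K) (A : VecField P 0 V) {μ ν : Fin P.d} (hμν : μ ≠ ν)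
    (S : (i : ℕ) → Finset (Site P i))
    (hS : ∀ i, i < k → ∀ y ∈ S (i + 1), ∀ (r : Fin P.d → Fin P.L) (s t : ℕ), s < P.L → t < P.L →
      runSite (runSite (Site.blockSite y r) μ s) ν t ∈ S i) :
    ((P.L : ℝ) ^ P.d) ^ k * ∑ y ∈ S k, ‖oc (bondAvgIter k A) μ ν y‖ ^ 2
      ≤ ((P.L : ℝ) ^ 2) ^ k * ∑ x ∈ S 0, ‖oc A μ ν x‖ ^ 2 := by
  induction k with
  | zero => simp [bondAvgIter_zero]
  | succ k ih =>
    have hk' : k ≤ P.m + P.K := by omega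
    have ih' := ih hk' fun i hi => hS i (by omega)
    -- one step at level `k` with the indicator weight of `S k`
    classical
    have hstep := sum_normSq_oc_bondAvg_le_weighted (j := k) hk (bondAvgIter k A) hμν (S (k + 1))
      (fun x => if x ∈ S k then (1 : ℝ) else 0) (fun x => by positivity)
      (fun y hy r s t hs ht => by rw [if_pos (hS k (by omega) y hy r s t hs ht)])
    have hind : ∑ x, (if x ∈ S k then (1 : ℝ) else 0) * ‖oc (bondAvgIter k A) μ ν x‖ ^ 2
        = ∑ x ∈ S k, ‖oc (bondAvgIter k A) μ ν x‖ ^ 2 := by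
      rw [← Finset.sum_filter_add_sum_filter_not Finset.univ (· ∈ S k)]
      rw [Finset.sum_eq_zero (s := Finset.univ.filter fun x => ¬ x ∈ S k)
        (fun x hx => by rw [if_neg (Finset.mem_filter.mp hx).2, zero_mul]), add_zero]
      have hf : Finset.univ.filter (· ∈ S k) = S k := by ext x; simp
      rw [hf]
      exact Finset.sum_congr rfl fun x hx => by rw [if_pos hx, one_mul]
    rw [hind, ← bondAvgIter_succ] at hstep
    have hL : (0 : ℝ) ≤ (P.L : ℝ) ^ 2 := by positivity
    calc ((P.L : ℝ) ^ P.d) ^ (k + 1) * ∑ y ∈ S (k + 1), ‖oc (bondAvgIter (k + 1) A) μ ν y‖ ^ 2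
        = ((P.L : ℝ) ^ P.d) ^ k * ((P.L : ℝ) ^ P.d * ∑ y ∈ S (k + 1), ‖oc (bondAvgIter (k + 1) A) μ ν y‖ ^ 2) := by ring
      _ ≤ ((P.L : ℝ) ^ P.d) ^ k * ((P.L : ℝ) ^ 2 * ∑ x ∈ S k, ‖oc (bondAvgIter k A) μ ν x‖ ^ 2) :=
          mul_le_mul_of_nonneg_left hstep (by positivity)
      _ = (P.L : ℝ) ^ 2 * (((P.L : ℝ) ^ P.d) ^ k * ∑ x ∈ S k, ‖oc (bondAvgIter k A) μ ν x‖ ^ 2) := by ring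
      _ ≤ (P.L : ℝ) ^ 2 * (((P.L : ℝ) ^ 2) ^ k * ∑ x ∈ S 0, ‖oc A μ ν x‖ ^ 2) := mul_le_mul_of_nonneg_left ih' hL
      _ = ((P.L : ℝ) ^ 2) ^ (k + 1) * ∑ x ∈ S 0, ‖oc A μ ν x‖ ^ 2 := by ring

/-- **… and its weighted reading**: with a fine weight `ζ ≥ 0` that is `≥ 1` on `S_0`,
`(L^d)^k · Σ_{y∈S_k} ‖oc (Q_kA) μ ν y‖² ≤ (L²)^k · Σ_x ζ(x)·‖oc A μ ν x‖²` (print: `ζ₀ ≡ 1` near `Λ`, [Balaban1989LargeFieldII] (1.6)).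
[cite: Federbush1986PhaseCellI, 'Abelian Stability Theorem' (0.12) p.321; Balaban1989LargeFieldII, (1.6)–(1.7) pp.357–358] -/
theorem sum_normSq_oc_bondAvgIter_le_weighted (k : ℕ) (hk : k ≤ P.m + P.K) (A : VecField P 0 V) {μ ν : Fin P.d} (hμν : μ ≠ ν)
    (S : (i : ℕ) → Finset (Site P i))
    (hS : ∀ i, i < k → ∀ y ∈ S (i + 1), ∀ (r : Fin P.d → Fin P.L) (s t : ℕ), s < P.L → t < P.L →
      runSite (runSite (Site.blockSite y r) μ s) ν t ∈ S i)
    (ζ : Site P 0 → ℝ) (hζ0 : ∀ x, 0 ≤ ζ x) (hζ1 : ∀ x ∈ S 0, 1 ≤ ζ x) :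
    ((P.L : ℝ) ^ P.d) ^ k * ∑ y ∈ S k, ‖oc (bondAvgIter k A) μ ν y‖ ^ 2
      ≤ ((P.L : ℝ) ^ 2) ^ k * ∑ x, ζ x * ‖oc A μ ν x‖ ^ 2 := by
  refine (sum_normSq_oc_bondAvgIter_le k hk A hμν S hS).trans (mul_le_mul_of_nonneg_left ?_ (by positivity))
  calc ∑ x ∈ S 0, ‖oc A μ ν x‖ ^ 2 ≤ ∑ x ∈ S 0, ζ x * ‖oc A μ ν x‖ ^ 2 :=
        Finset.sum_le_sum fun x hx => le_mul_of_one_le_left (by positivity) (hζ1 x hx)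
    _ ≤ ∑ x, ζ x * ‖oc A μ ν x‖ ^ 2 :=
        Finset.sum_le_sum_of_subset_of_nonneg (Finset.subset_univ _) fun x _ _ => mul_nonneg (hζ0 x) (by positivity)

/-- ★★ **THE SAME FOR ANY CHAIN OF AVERAGES WHOSE PLAQUETTE VARIABLES ARE `c`·(THOSE OF THE STRAIGHT-LINE AVERAGE)** — e.g. the `k`-fold
iterate of NODE 00's linearised (0.4) average (`oc_linAvg`: `c = L`, the gauge tails being invisible to plaquettes): for fields `Y_i` on
`T^{(i)}` with `oc (Y_{i+1}) = c • oc (Q Y_i)` on the plaquettes of `S_{i+1}` and the stencil nesting of `sum_normSq_oc_bondAvgIter_le`,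
`(L^d)^k · Σ_{y∈S_k} ‖oc (Y_k) μ ν y‖² ≤ (c²L²)^k · Σ_{x∈S_0} ‖oc (Y_0) μ ν x‖²`.
[cite: Federbush1986PhaseCellI, 'Abelian Stability Theorem' (0.12) p.321; Balaban1985Averaging, (124)-(125) p.36; Balaban1989LargeFieldII, (1.7) p.358] -/
theorem sum_normSq_oc_chain_le (k : ℕ) (hk : k ≤ P.m + P.K) (c : ℝ) (Y : (i : ℕ) → VecField P i V) {μ ν : Fin P.d} (hμν : μ ≠ ν)
    (S : (i : ℕ) → Finset (Site P i))
    (hS : ∀ i, i < k → ∀ y ∈ S (i + 1), ∀ (r : Fin P.d → Fin P.L) (s t : ℕ), s < P.L → t < P.L →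
      runSite (runSite (Site.blockSite y r) μ s) ν t ∈ S i)
    (hY : ∀ i, i < k → ∀ y ∈ S (i + 1), oc (Y (i + 1)) μ ν y = c • oc (bondAvg (Y i)) μ ν y) :
    ((P.L : ℝ) ^ P.d) ^ k * ∑ y ∈ S k, ‖oc (Y k) μ ν y‖ ^ 2
      ≤ (c ^ 2 * (P.L : ℝ) ^ 2) ^ k * ∑ x ∈ S 0, ‖oc (Y 0) μ ν x‖ ^ 2 := by
  induction k with
  | zero => simp
  | succ k ih =>
    have hk' : k ≤ P.m + P.K := by omega
    have ih' := ih hk' (fun i hi => hS i (by omega)) (fun i hi => hY i (by omega))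
    classical
    have hstep := sum_normSq_oc_bondAvg_le_weighted (j := k) hk (Y k) hμν (S (k + 1))
      (fun x => if x ∈ S k then (1 : ℝ) else 0) (fun x => by positivity)
      (fun y hy r s t hs ht => by rw [if_pos (hS k (by omega) y hy r s t hs ht)])
    have hind : ∑ x, (if x ∈ S k then (1 : ℝ) else 0) * ‖oc (Y k) μ ν x‖ ^ 2 = ∑ x ∈ S k, ‖oc (Y k) μ ν x‖ ^ 2 := by
      rw [← Finset.sum_filter_add_sum_filter_not Finset.univ (· ∈ S k)]
      rw [Finset.sum_eq_zero (s := Finset.univ.filter fun x => ¬ x ∈ S k)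
        (fun x hx => by rw [if_neg (Finset.mem_filter.mp hx).2, zero_mul]), add_zero]
      have hf : Finset.univ.filter (· ∈ S k) = S k := by ext x; simp
      rw [hf]
      exact Finset.sum_congr rfl fun x hx => by rw [if_pos hx, one_mul]
    rw [hind] at hstep
    -- the plaquette variables of `Y (k+1)` on `S (k+1)` are `c •` those of `Q (Y k)`
    have hc : ∑ y ∈ S (k + 1), ‖oc (Y (k + 1)) μ ν y‖ ^ 2 = c ^ 2 * ∑ y ∈ S (k + 1), ‖oc (bondAvg (Y k)) μ ν y‖ ^ 2 := by
      rw [Finset.mul_sum]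
      exact Finset.sum_congr rfl fun y hy => by rw [hY k (by omega) y hy, norm_smul, mul_pow, Real.norm_eq_abs, sq_abs]
    have hc0 : (0 : ℝ) ≤ c ^ 2 * (P.L : ℝ) ^ 2 := by positivity
    calc ((P.L : ℝ) ^ P.d) ^ (k + 1) * ∑ y ∈ S (k + 1), ‖oc (Y (k + 1)) μ ν y‖ ^ 2
        = c ^ 2 * ((P.L : ℝ) ^ P.d) ^ k * ((P.L : ℝ) ^ P.d * ∑ y ∈ S (k + 1), ‖oc (bondAvg (Y k)) μ ν y‖ ^ 2) := by rw [hc]; ring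
      _ ≤ c ^ 2 * ((P.L : ℝ) ^ P.d) ^ k * ((P.L : ℝ) ^ 2 * ∑ x ∈ S k, ‖oc (Y k) μ ν x‖ ^ 2) :=
          mul_le_mul_of_nonneg_left hstep (by positivity)
      _ = c ^ 2 * (P.L : ℝ) ^ 2 * (((P.L : ℝ) ^ P.d) ^ k * ∑ x ∈ S k, ‖oc (Y k) μ ν x‖ ^ 2) := by ring
      _ ≤ c ^ 2 * (P.L : ℝ) ^ 2 * ((c ^ 2 * (P.L : ℝ) ^ 2) ^ k * ∑ x ∈ S 0, ‖oc (Y 0) μ ν x‖ ^ 2) :=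
          mul_le_mul_of_nonneg_left ih' hc0
      _ = (c ^ 2 * (P.L : ℝ) ^ 2) ^ (k + 1) * ∑ x ∈ S 0, ‖oc (Y 0) μ ν x‖ ^ 2 := by ring

end Iterate

/-! ## §7  Plaquette-indexed form (the `Σ_p` of [B5] (1.3)∕(1.21) and of NODE 00's second variation) -/

section PlaqForm

variable {V : Type*} [NormedAddCommGroup V] [NormedSpace ℝ V]

omit [NormedSpace ℝ V] in
/-- A sum over the plaquettes of `T^{(j)}` is the sum over base points and ORDERED direction pairs `μ < ν`. [folklore] -/
private theorem sum_plaq_eq {M : Type*} [AddCommMonoid M] (f : Site P j → Fin P.d → Fin P.d → M) :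
    ∑ p : Plaq P j, f p.src p.μ p.ν = ∑ x : Site P j, ∑ μ : Fin P.d, ∑ ν : Fin P.d, if μ < ν then f x μ ν else 0 := by
  classical
  have hinj : Function.Injective (fun p : Plaq P j => (p.src, p.μ, p.ν)) := by
    rintro ⟨x, μ, ν, h⟩ ⟨x', μ', ν', h'⟩ hpq
    simp only [Prod.mk.injEq] at hpq
    obtain ⟨h1, h2, h3⟩ := hpq
    subst h1; subst h2; subst h3
    rfl
  have himg : (Finset.univ : Finset (Plaq P j)).image (fun p => (p.src, p.μ, p.ν))
      = Finset.univ.filter (fun t : Site P j × Fin P.d × Fin P.d => t.2.1 < t.2.2) := by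
    ext t
    simp only [Finset.mem_image, Finset.mem_univ, true_and, Finset.mem_filter]
    constructor
    · rintro ⟨p, rfl⟩
      exact p.hμν
    · intro ht
      exact ⟨⟨t.1, t.2.1, t.2.2, ht⟩, rfl⟩
  calc ∑ p : Plaq P j, f p.src p.μ p.ν
      = ∑ t ∈ (Finset.univ : Finset (Plaq P j)).image (fun p => (p.src, p.μ, p.ν)), f t.1 t.2.1 t.2.2 := by
        rw [Finset.sum_image fun p _ q _ h => hinj h]
    _ = ∑ t ∈ Finset.univ.filter (fun t : Site P j × Fin P.d × Fin P.d => t.2.1 < t.2.2), f t.1 t.2.1 t.2.2 := by rw [himg]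
    _ = ∑ t : Site P j × Fin P.d × Fin P.d, if t.2.1 < t.2.2 then f t.1 t.2.1 t.2.2 else 0 := Finset.sum_filter _ _
    _ = ∑ x : Site P j, ∑ μ : Fin P.d, ∑ ν : Fin P.d, if μ < ν then f x μ ν else 0 := by
        rw [Fintype.sum_prod_type]
        exact Finset.sum_congr rfl fun x _ => by rw [Fintype.sum_prod_type]

/-- ★★ **FEDERBUSH LOCALIZED AND WEIGHTED, PLAQUETTE-INDEXED** (standing range): for a set `S` of coarse base points and a fine SITE weight `w ≥ 0`
that is `≥ 1` on the stencils of `S` in every plane, `L^d · Σ_{p ⊂ T^{(j+1)}, p₋∈S} ‖oc (QA) p‖² ≤ L² · Σ_{q ⊂ T^{(j)}} w(q₋)·‖oc A q‖²` — the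
`Σ_p` of `LatticeFieldCalculus.curlAction` and of NODE 00's flat second variation `(1∕N)Σ_p‖σ⁰_p‖²` (dag-n12-w2's
`Node00.deriv_deriv_wilsonAction4_expChart_one_eq_norm_sq`, `σ⁰_p = oc X p.μ p.ν p.src`). [cite: Federbush1986PhaseCellI, 'Abelian Stability Theorem' (0.12) p.321;
Balaban1984PropagatorsI, (1.3) p.18, (1.21) p.21; Balaban1989LargeFieldII, (1.7) p.358] -/
theorem sum_plaq_normSq_oc_bondAvg_le_weighted (hj : j + 1 ≤ P.m + P.K) (A : VecField P j V)
    (S : Finset (Site P (j + 1))) (w : Site P j → ℝ) (hw0 : ∀ x, 0 ≤ w x)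
    (hw1 : ∀ (μ ν : Fin P.d), μ < ν → ∀ y ∈ S, ∀ (r : Fin P.d → Fin P.L) (s t : ℕ), s < P.L → t < P.L →
      1 ≤ w (runSite (runSite (Site.blockSite y r) μ s) ν t)) :
    (P.L : ℝ) ^ P.d * ∑ p : Plaq P (j + 1), (if p.src ∈ S then ‖oc (bondAvg A) p.μ p.ν p.src‖ ^ 2 else 0)
      ≤ (P.L : ℝ) ^ 2 * ∑ q : Plaq P j, w q.src * ‖oc A q.μ q.ν q.src‖ ^ 2 := by
  classical
  rw [sum_plaq_eq (fun (x : Site P (j + 1)) (μ ν : Fin P.d) => if x ∈ S then ‖oc (bondAvg A) μ ν x‖ ^ 2 else 0),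
    sum_plaq_eq (fun (x : Site P j) (μ ν : Fin P.d) => w x * ‖oc A μ ν x‖ ^ 2)]
  -- bring the plane sums outside on both sides
  rw [Finset.sum_comm, Finset.mul_sum, Finset.sum_comm (s := (Finset.univ : Finset (Site P j))), Finset.mul_sum]
  refine Finset.sum_le_sum fun μ _ => ?_
  rw [Finset.sum_comm, Finset.mul_sum, Finset.sum_comm (s := (Finset.univ : Finset (Site P j))), Finset.mul_sum]
  refine Finset.sum_le_sum fun ν _ => ?_
  by_cases hμν : μ < ν
  · simp only [if_pos hμν]
    have h := sum_normSq_oc_bondAvg_le_weighted hj A (ne_of_lt hμν) S w hw0 (hw1 μ ν hμν)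
    have hl : ∑ x : Site P (j + 1), (if x ∈ S then ‖oc (bondAvg A) μ ν x‖ ^ 2 else 0)
        = ∑ y ∈ S, ‖oc (bondAvg A) μ ν y‖ ^ 2 := by
      rw [← Finset.sum_filter]
      have hf : Finset.univ.filter (· ∈ S) = S := by ext x; simp
      rw [hf]
    rw [hl]
    exact h
  · simp only [if_neg hμν, Finset.sum_const_zero, mul_zero, le_refl]

end PlaqForm

/-! ## §8 (v1.1, append-only)  Plaquette-indexed form of the `k`-fold ∕ chain estimates -/

section PlaqChain

variable {V : Type*} [NormedAddCommGroup V] [NormedSpace ℝ V]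

omit [NormedSpace ℝ V] in
/-- A sum over the plaquettes of `T^{(j)}` is the sum over ORDERED direction pairs `μ < ν` of the sums over base points (re-statement of
§7's private reindexing for this section). [folklore] -/
private theorem sum_plaq_eq' {M : Type*} [AddCommMonoid M] (f : Site P j → Fin P.d → Fin P.d → M) :
    ∑ p : Plaq P j, f p.src p.μ p.ν = ∑ μ : Fin P.d, ∑ ν : Fin P.d, if μ < ν then ∑ x : Site P j, f x μ ν else 0 := by
  rw [sum_plaq_eq f, Finset.sum_comm]
  refine Finset.sum_congr rfl fun μ _ => ?_
  rw [Finset.sum_comm]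
  refine Finset.sum_congr rfl fun ν _ => ?_
  by_cases h : μ < ν
  · simp only [if_pos h]
  · simp only [if_neg h, Finset.sum_const_zero]

/-- ★★ **THE CHAIN ESTIMATE, PLAQUETTE-INDEXED**: for fields `Y_i` on `T^{(i)}` with `oc (Y_{i+1}) = c • oc (Q Y_i)` on the plaquettes based in
`S_{i+1}` (every plane), the stencil nesting `S_i ⊇` stencils of `S_{i+1}` (every plane), and a fine site weight `ζ ≥ 0` with `ζ ≥ 1` on `S_0`:
`(L^d)^k · Σ_{p ⊂ T^{(k)}, p₋ ∈ S_k} ‖oc (Y_k) p‖² ≤ (c²L²)^k · Σ_{q ⊂ T^{(0)}} ζ(q₋)·‖oc (Y_0) q‖²` — the shape that pairs with the `Σ_{p : Plaq}` flat second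
variation of NODE 00 (dag-n12-w2's `Node00.deriv_deriv_wilsonAction4_expChart_one_eq_norm_sq`) and with the window circulation sum of the N12∕s1
`h17` letter. [cite: Federbush1986PhaseCellI, 'Abelian Stability Theorem' (0.12) p.321; Balaban1984PropagatorsI, (1.18) p.20, (1.21) p.21;
Balaban1989LargeFieldII, (1.6)–(1.7) pp.357–358] -/
theorem sum_plaq_normSq_oc_chain_le (k : ℕ) (hk : k ≤ P.m + P.K) (c : ℝ) (Y : (i : ℕ) → VecField P i V)
    (S : (i : ℕ) → Finset (Site P i))
    (hS : ∀ (μ ν : Fin P.d), μ < ν → ∀ i, i < k → ∀ y ∈ S (i + 1), ∀ (r : Fin P.d → Fin P.L) (s t : ℕ), s < P.L → t < P.L →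
      runSite (runSite (Site.blockSite y r) μ s) ν t ∈ S i)
    (hY : ∀ (μ ν : Fin P.d), μ < ν → ∀ i, i < k → ∀ y ∈ S (i + 1), oc (Y (i + 1)) μ ν y = c • oc (bondAvg (Y i)) μ ν y)
    (ζ : Site P 0 → ℝ) (hζ0 : ∀ x, 0 ≤ ζ x) (hζ1 : ∀ x ∈ S 0, 1 ≤ ζ x) :
    ((P.L : ℝ) ^ P.d) ^ k * ∑ p : Plaq P k, (if p.src ∈ S k then ‖oc (Y k) p.μ p.ν p.src‖ ^ 2 else 0)
      ≤ (c ^ 2 * (P.L : ℝ) ^ 2) ^ k * ∑ q : Plaq P 0, ζ q.src * ‖oc (Y 0) q.μ q.ν q.src‖ ^ 2 := by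
  classical
  rw [sum_plaq_eq' (fun (x : Site P k) (μ ν : Fin P.d) => if x ∈ S k then ‖oc (Y k) μ ν x‖ ^ 2 else 0),
    sum_plaq_eq' (fun (x : Site P 0) (μ ν : Fin P.d) => ζ x * ‖oc (Y 0) μ ν x‖ ^ 2), Finset.mul_sum, Finset.mul_sum]
  refine Finset.sum_le_sum fun μ _ => ?_
  rw [Finset.mul_sum, Finset.mul_sum]
  refine Finset.sum_le_sum fun ν _ => ?_
  by_cases hμν : μ < ν
  · simp only [if_pos hμν]
    have h := sum_normSq_oc_chain_le k hk c Y (ne_of_lt hμν) S (hS μ ν hμν) (hY μ ν hμν)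
    have hl : ∑ x : Site P k, (if x ∈ S k then ‖oc (Y k) μ ν x‖ ^ 2 else 0) = ∑ y ∈ S k, ‖oc (Y k) μ ν y‖ ^ 2 := by
      rw [← Finset.sum_filter]
      have hf : Finset.univ.filter (· ∈ S k) = S k := by ext x; simp
      rw [hf]
    rw [hl]
    refine h.trans (mul_le_mul_of_nonneg_left ?_ (by positivity))
    calc ∑ x ∈ S 0, ‖oc (Y 0) μ ν x‖ ^ 2 ≤ ∑ x ∈ S 0, ζ x * ‖oc (Y 0) μ ν x‖ ^ 2 :=
          Finset.sum_le_sum fun x hx => le_mul_of_one_le_left (by positivity) (hζ1 x hx)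
      _ ≤ ∑ x, ζ x * ‖oc (Y 0) μ ν x‖ ^ 2 :=
          Finset.sum_le_sum_of_subset_of_nonneg (Finset.subset_univ _) fun x _ _ => mul_nonneg (hζ0 x) (by positivity)
  · simp only [if_neg hμν, mul_zero, le_refl]

/-- **The `Q_k` case** (`Y_i = Q_i A`, `c = 1`): `(L^d)^k · Σ_{p ⊂ T^{(k)}, p₋ ∈ S_k} ‖oc (Q_kA) p‖² ≤ (L²)^k · Σ_{q ⊂ T^{(0)}} ζ(q₋)·‖oc A q‖²`.
[cite: Federbush1986PhaseCellI, 'Abelian Stability Theorem' (0.12) p.321; Balaban1984PropagatorsI, (1.18) p.20] -/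
theorem sum_plaq_normSq_oc_bondAvgIter_le (k : ℕ) (hk : k ≤ P.m + P.K) (A : VecField P 0 V)
    (S : (i : ℕ) → Finset (Site P i))
    (hS : ∀ (μ ν : Fin P.d), μ < ν → ∀ i, i < k → ∀ y ∈ S (i + 1), ∀ (r : Fin P.d → Fin P.L) (s t : ℕ), s < P.L → t < P.L →
      runSite (runSite (Site.blockSite y r) μ s) ν t ∈ S i)
    (ζ : Site P 0 → ℝ) (hζ0 : ∀ x, 0 ≤ ζ x) (hζ1 : ∀ x ∈ S 0, 1 ≤ ζ x) :
    ((P.L : ℝ) ^ P.d) ^ k * ∑ p : Plaq P k, (if p.src ∈ S k then ‖oc (bondAvgIter k A) p.μ p.ν p.src‖ ^ 2 else 0)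
      ≤ ((P.L : ℝ) ^ 2) ^ k * ∑ q : Plaq P 0, ζ q.src * ‖oc A q.μ q.ν q.src‖ ^ 2 := by
  have h := sum_plaq_normSq_oc_chain_le k hk 1 (fun i => bondAvgIter i A) S hS
    (fun μ ν _ i _ y _ => by rw [bondAvgIter_succ, one_smul]) ζ hζ0 hζ1
  simpa only [one_pow, one_mul, bondAvgIter_zero] using h

end PlaqChain

end Literature.MathematicalPhysics.QuantumFieldTheory.Balaban1983to89.B5AverageCurlStokesV1

end
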